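import Literature.Computability.AlgebraicComplexity.BigCwSquareFormatValue112
import Literature.Computability.AlgebraicComplexity.LaserFormatPoolingData
import Literature.Computability.AlgebraicComplexity.LaserFormatWordValue
import HarnessLib

/-!
# The joint format value of the family `[112], [121], [211]` of `CW_q^{⊗2}` (Le Gall 2012 §6)

Topic `Literature/Computability/AlgebraicComplexity`.  In the second power of the
Coppersmith–Winograd tensor the three components `T^{[112]}`, `T^{[121]}`, `T^{[211]}` are not
matrix products; Coppersmith–Winograd (1990, §8) value each separately by an inner laser step on
its four pair components (`BigCwSquareFormatValue112`: `2^{min(1,H_Z(σ))}` products of format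
`(q^{1−σ}, q^σ, q^σ)`), and Le Gall (2012, §6.1, Prop. 6.2; the `𝒞`-tensor of §4) observes that for
RECTANGULAR products the inner extractions of the three components must be performed JOINTLY —
the entropy budgets of the three coordinates are pooled over the family, so that the deficient
`x`-coordinate of `[211]` borrows from the saturated `x`-coordinates of `[112]` and `[121]`.
In the tree's currency this joint extraction is NESTED POOLING
(`laserMethod_hasFormatValue_pair_of_mul`, `LaserFormatPoolingData`): this file sets up the pair
data of

* `T^{[211]}` (support `cwS211` of four products `T_{200}⊗T_{011}`, `T_{011}⊗T_{200}` of format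
  `(1,q,1)` and `T_{110}⊗T_{101}`, `T_{101}⊗T_{110}` of format `(q,1,q)`; law `(1−τ)/2, (1−τ)/2,
  τ/2, τ/2`, product form, marginal entropies `(H₃(τ), 1, 1)` with
  `H₃(τ) = (2η((1−τ)/2) + η(τ))/ln 2`),
* the zero-outs `T^{[112]}'` (`z`-pair-label `(1,1)`: the two products of format `(1,q,q)`, law
  `1/2, 1/2`, entropies `(1,1,0)`) and `T^{[121]}'` (`y`-pair-label `(1,1)`: format `(q,q,1)`,
  entropies `(1,0,1)`),

and proves **`hasFormatValue_cwSqFamily`: the family tensor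
`F_q = (T^{[112]}' ⊗ T^{[121]}') ⊗ (T^{[211]} ⊗ T^{[211]})` is worth `2^{min(2 + 2H₃(τ), 3)}`
products of format `(q^{1+2τ}, q^{4−2τ}, q^{1+2τ})`** for every rational `τ ∈ (0,1)` (pooled
budgets `X : 1+1+2H₃(τ)`, `Y : 1+0+1+1`, `Z : 0+1+1+1`; all penalties zero), together with its
transfer `hasFormatValue_laserBlock_cwSqFamWord` to the block of `(CW_q^{⊗2})^{⊗4}` with label word
`cwSqFamWord = ([112],[121],[211],[211])` — the jointly valued family word consumed by
`laserMethod_hasFormatValue_of_wordValue` in the level-2 rectangular analysis.  (Separate inner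
values give `x`-budget `1 + 1 + 2·min(1,H₃)`-free formats but force `[211]`'s own `x`-entropy
`H₃(τ) ≥` its own needs, which caps the level-2 dual exponent below level 1; the pooled form is
what reaches Le Gall's `α > 0.302`.)

Library fit: proofs and data only (`cwSqComp_pair`, the level-1 format values
`hasFormatValue_cwComp…`, `laserMethod_hasFormatValue_pair_of_mul`, `LaserFormatPoolingData`,
`LaserFormatWordValue`); definitions are the explicit supports / formats / counts / laws and the
two zero-outs; no named facts, no sorry.  Searched: `cwS112`, `hasFormatValue_cwSqComp112`,
`pairSupport`, `Prop 6.2`, `[211]` — the tree had the separate values of the three components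
(`BigCwSquareFormatValue112`) and the pooling theorems, not the family's joint value.

## References

* D. Coppersmith, S. Winograd, *Matrix multiplication via arithmetic progressions*,
  J. Symbolic Comput. 9 (1990), §8. [CoppersmithWinograd1990]
* F. Le Gall, *Faster algorithms for rectangular matrix multiplication*, FOCS 2012,
  arXiv:1204.1111, §4 (the `𝒞`-tensor), §6.1 and Prop. 6.2. [LeGall2012]
* F. Le Gall, *Powers of tensors and fast matrix multiplication*, ISSAC 2014, arXiv:1401.7714,
  Thm. 4.1, §5. [LeGall2014]
* D. Coppersmith, *Rectangular matrix multiplication revisited*, J. Complexity 13 (1997), §3.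
  [Coppersmith1997]
-/

set_option autoImplicit false
set_option linter.style.longLine false
set_option linter.unusedSectionVars false
set_option linter.unusedVariables false

noncomputable section

open Finset Real
open scoped BigOperators

universe u

namespace Literature.Computability.AlgebraicComplexity

open Literature.Barriers.MatrixMultiplication

/-! ## Levels of the support of a level-2 component -/

section Levels

variable (K : Type u) [Field K] (q : ℕ)

/-- **The pair levels on the support of `T^{[IJL]}`**: `lev(x₁)+lev(x₂) = I`, `lev(y₁)+lev(y₂) = J`,
`lev(z₁)+lev(z₂) = L` and both coordinate triples lie in the support of `CW_q`
(`lev(x_m)+lev(y_m)+lev(z_m) = 2`). [cite: CoppersmithWinograd1990, §8] [cite: LeGall2014, §5] -/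
theorem cwSqComp_levels {I J L : Fin 5} {x y z : Fin (q + 2) × Fin (q + 2)}
    (h : cwSqComp K q I J L x y z ≠ 0) :
    cwLevel x.1 + cwLevel x.2 = I ∧ cwLevel y.1 + cwLevel y.2 = J ∧ cwLevel z.1 + cwLevel z.2 = L ∧
      cwLevel x.1 + cwLevel y.1 + cwLevel z.1 = 2 ∧ cwLevel x.2 + cwLevel y.2 + cwLevel z.2 = 2 := by
  have h' : (if cwLev2 x ∈ ({I} : Finset (Fin 5)) ∧ cwLev2 y ∈ ({J} : Finset (Fin 5)) ∧
      cwLev2 z ∈ ({L} : Finset (Fin 5)) then bigCwSq K q x y z else 0) ≠ 0 := h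
  clear h
  split_ifs at h' with hc
  · simp only [Finset.mem_singleton] at hc
    obtain ⟨hx, hy, hz⟩ := hc
    obtain ⟨h1, h2⟩ := bigCwSq_pairSupport K q x y z h'
    rw [mem_cwSupport₃] at h1 h2
    have ex := congrArg Fin.val hx; have ey := congrArg Fin.val hy; have ez := congrArg Fin.val hz
    simp only [coe_cwLevSum, cwLevel₃_val] at ex ey ez h1 h2
    exact ⟨ex, ey, ez, h1, h2⟩
  · exact absurd rfl h'

end Levels

/-! ## The pair data of `T^{[211]}` -/

section Data211

/-- **The four pair components of `T^{[211]}`**: `T_{200}⊗T_{011}`, `T_{011}⊗T_{200}` (format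
`(1,q,1)`) and `T_{110}⊗T_{101}`, `T_{101}⊗T_{110}` (format `(q,1,q)`), by pair labels
`((i,i'),(j,j'),(l,l'))`. [cite: CoppersmithWinograd1990, §8] -/
def cwS211 : Finset (PL × PL × PL) :=
  {((2, 0), (0, 1), (0, 1)), ((0, 2), (1, 0), (1, 0)), ((1, 1), (1, 0), (0, 1)), ((1, 1), (0, 1), (1, 0))}

/-- The tightness relation on `cwS211` (the pair tightness maps of `BigCwSquareValue112`).
[cite: LeGall2014, §5] -/
theorem cwTight211_sum (s : PL × PL × PL) (hs : s ∈ cwS211) (k : Fin 2) :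
    cwTight112 s.1 k + cwTight112 s.2.1 k + cwTight112γ s.2.2 k = 0 := by
  simp only [cwS211, Finset.mem_insert, Finset.mem_singleton] at hs
  rcases hs with rfl | rfl | rfl | rfl <;> fin_cases k <;> simp [cwTight112, cwTight112γ]

variable (K : Type u) [Field K] (q : ℕ)

/-- **The pair labels of the support of `T^{[211]}` lie in `cwS211`.** [cite: CoppersmithWinograd1990, §8] -/
theorem cwSqComp211_support (x y z : Fin (q + 2) × Fin (q + 2)) (h : cwSqComp K q 2 1 1 x y z ≠ 0) :
    (cwPairLev x, cwPairLev y, cwPairLev z) ∈ cwS211 := by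
  obtain ⟨ex, ey, ez, h1, h2⟩ := cwSqComp_levels K q h
  simp only [Fin.isValue, Fin.val_two, Fin.val_one] at ex ey ez
  have bx1 := cwLevel_le_two x.1; have bx2 := cwLevel_le_two x.2
  simp only [cwS211, Finset.mem_insert, Finset.mem_singleton, Prod.mk.injEq, cwPairLev, Fin.ext_iff,
    cwLevel₃_val, Fin.isValue, Fin.val_zero, Fin.val_one, Fin.val_two]
  omega

/-- First (= third) format of the pair components of `[211]`: `q` on the two `(q,1,q)`-products
(`x`-pair-label `(1,1)`), `1` on the two `(1,q,1)`-products. [cite: CoppersmithWinograd1990, §8] -/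
def cwF211A (s : PL × PL × PL) : ℝ := if s.1 = (1, 1) then (q : ℝ) else 1

/-- Second format of the pair components of `[211]`: `1` resp. `q`. [cite: CoppersmithWinograd1990, §8] -/
def cwF211B (s : PL × PL × PL) : ℝ := if s.1 = (1, 1) then 1 else (q : ℝ)

/-- The values of the format data on the four pairs. [folklore] -/
private theorem cwF211_values :
    cwF211A q ((2, 0), (0, 1), (0, 1)) = 1 ∧ cwF211A q ((0, 2), (1, 0), (1, 0)) = 1 ∧
    cwF211A q ((1, 1), (1, 0), (0, 1)) = q ∧ cwF211A q ((1, 1), (0, 1), (1, 0)) = q ∧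
    cwF211B q ((2, 0), (0, 1), (0, 1)) = q ∧ cwF211B q ((0, 2), (1, 0), (1, 0)) = q ∧
    cwF211B q ((1, 1), (1, 0), (0, 1)) = 1 ∧ cwF211B q ((1, 1), (0, 1), (1, 0)) = 1 := by
  refine ⟨?_, ?_, ?_, ?_, ?_, ?_, ?_, ?_⟩ <;> simp [cwF211A, cwF211B]

/-- `cwF211A > 0` (for `q ≥ 1`). [folklore] -/
private theorem cwF211A_pos (hq : 1 ≤ q) (s : PL × PL × PL) : 0 < cwF211A q s := by
  have : (0 : ℝ) < q := by exact_mod_cast hq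
  simp only [cwF211A]; split_ifs <;> positivity

/-- `cwF211B > 0` (for `q ≥ 1`). [folklore] -/
private theorem cwF211B_pos (hq : 1 ≤ q) (s : PL × PL × PL) : 0 < cwF211B q s := by
  have : (0 : ℝ) < q := by exact_mod_cast hq
  simp only [cwF211B]; split_ifs <;> positivity

/-- **The format values of the four products of `[211]`** (`cwSqComp_pair` and the level-1
formats): format `(cwF211A, cwF211B, cwF211A)`, one product each. [cite: CoppersmithWinograd1990, §8]
[cite: LeGall2012, §6.1] -/
theorem hasFormatValue_cwS211 (s : PL × PL × PL) (hs : s ∈ cwS211) :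
    HasFormatValue (partSubtensor cwPairLev cwPairLev cwPairLev (cwSqComp K q 2 1 1)
      {s.1} {s.2.1} {s.2.2}) 1 (cwF211A q s) (cwF211B q s) (cwF211A q s) := by
  have hq0 : (0 : ℝ) ≤ q := Nat.cast_nonneg q
  obtain ⟨a1, a2, a3, a4, b1, b2, b3, b4⟩ := cwF211_values q
  simp only [cwS211, Finset.mem_insert, Finset.mem_singleton] at hs
  rcases hs with rfl | rfl | rfl | rfl
  · rw [a1, b1, cwSqComp_pair, if_pos (by refine ⟨?_, ?_, ?_⟩ <;> ext <;> simp)]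
    have h := (hasFormatValue_cwComp200 K q).kronecker (hasFormatValue_cwComp011 K q) zero_le_one
      zero_le_one zero_le_one zero_le_one zero_le_one hq0 zero_le_one zero_le_one
    simpa using h
  · rw [a2, b2, cwSqComp_pair, if_pos (by refine ⟨?_, ?_, ?_⟩ <;> ext <;> simp)]
    have h := (hasFormatValue_cwComp011 K q).kronecker (hasFormatValue_cwComp200 K q) zero_le_one
      zero_le_one zero_le_one zero_le_one hq0 zero_le_one zero_le_one zero_le_one
    simpa using h
  · rw [a3, b3, cwSqComp_pair, if_pos (by refine ⟨?_, ?_, ?_⟩ <;> ext <;> simp)]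
    have h := (hasFormatValue_cwComp110 K q).kronecker (hasFormatValue_cwComp101 K q) zero_le_one
      zero_le_one hq0 zero_le_one zero_le_one zero_le_one zero_le_one hq0
    simpa using h
  · rw [a4, b4, cwSqComp_pair, if_pos (by refine ⟨?_, ?_, ?_⟩ <;> ext <;> simp)]
    have h := (hasFormatValue_cwComp101 K q).kronecker (hasFormatValue_cwComp110 K q) zero_le_one
      zero_le_one zero_le_one hq0 zero_le_one zero_le_one hq0 zero_le_one
    simpa using h

/-- **The counts of the splitting `τ = b/(a+b)`**: `a` on each `(1,q,1)`-product, `b` on each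
`(q,1,q)`-product (total `2(a+b)`). [cite: LeGall2012, §6.1] [cite: CoppersmithWinograd1990, §8] -/
def cwC211 (a b : ℕ) (s : PL × PL × PL) : ℕ :=
  if s ∈ cwS211 then (if s.1 = (1, 1) then b else a) else 0

/-- The four counts. [folklore] -/
private theorem cwC211_values (a b : ℕ) :
    cwC211 a b ((2, 0), (0, 1), (0, 1)) = a ∧ cwC211 a b ((0, 2), (1, 0), (1, 0)) = a ∧
    cwC211 a b ((1, 1), (1, 0), (0, 1)) = b ∧ cwC211 a b ((1, 1), (0, 1), (1, 0)) = b := by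
  refine ⟨?_, ?_, ?_, ?_⟩ <;> simp [cwC211, cwS211]

/-- `cwC211` vanishes off `cwS211`. [folklore] -/
private theorem cwC211_eq_zero (a b : ℕ) (s : PL × PL × PL) (hs : s ∉ cwS211) : cwC211 a b s = 0 := by
  simp [cwC211, hs]

/-- `∑ cwC211 a b = 2(a+b)`. [folklore] -/
private theorem sum_cwC211 (a b : ℕ) : ∑ s, cwC211 a b s = 2 * (a + b) := by
  rw [← Finset.sum_subset (Finset.subset_univ cwS211) (fun s _ hs => cwC211_eq_zero a b s hs)]
  obtain ⟨e1, e2, e3, e4⟩ := cwC211_values a b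
  simp only [cwS211]
  rw [Finset.sum_insert (by decide), Finset.sum_insert (by decide), Finset.sum_insert (by decide),
    Finset.sum_singleton, e1, e2, e3, e4]
  omega

/-- **The law of the splitting**: `(1−τ)/2` on each `(1,q,1)`-product, `τ/2` on each
`(q,1,q)`-product. [cite: LeGall2012, §6.1] [cite: CoppersmithWinograd1990, §8] -/
def cwP211 (τ : ℝ) (s : PL × PL × PL) : ℝ :=
  if s ∈ cwS211 then (if s.1 = (1, 1) then τ / 2 else (1 - τ) / 2) else 0

/-- The four values of the law. [folklore] -/
private theorem cwP211_values (τ : ℝ) :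
    cwP211 τ ((2, 0), (0, 1), (0, 1)) = (1 - τ) / 2 ∧ cwP211 τ ((0, 2), (1, 0), (1, 0)) = (1 - τ) / 2 ∧
    cwP211 τ ((1, 1), (1, 0), (0, 1)) = τ / 2 ∧ cwP211 τ ((1, 1), (0, 1), (1, 0)) = τ / 2 := by
  refine ⟨?_, ?_, ?_, ?_⟩ <;> simp [cwP211, cwS211]

/-- `cwP211 τ` vanishes off `cwS211`. [folklore] -/
private theorem cwP211_eq_zero (τ : ℝ) (s : PL × PL × PL) (hs : s ∉ cwS211) : cwP211 τ s = 0 := by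
  simp [cwP211, hs]

/-- `cwP211 (b/(a+b)) = cwC211 a b / (2(a+b))`. [folklore] -/
private theorem cwP211_eq_cwC211_div {a b : ℕ} (hab : 0 < a + b) {τ : ℝ} (hτ : τ = (b : ℝ) / (a + b))
    (s : PL × PL × PL) : cwP211 τ s = (cwC211 a b s : ℝ) / ((2 * (a + b) : ℕ) : ℝ) := by
  have h0 : ((a : ℝ) + b) ≠ 0 := by exact_mod_cast hab.ne'
  by_cases hs : s ∈ cwS211
  · simp only [cwP211, cwC211, if_pos hs]
    split_ifs
    · rw [hτ]; push_cast; field_simp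
    · rw [hτ]; push_cast; field_simp; ring
  · simp [cwP211, cwC211, hs]

/-- The product-form factor of the law (first coordinate; the other two factors are `1`).
[cite: LeGall2014, Prop. 4.1] -/
def cwf211 (τ : ℝ) (x : PL) : ℝ := if x = (1, 1) then τ / 2 else (1 - τ) / 2

/-- `cwf211 > 0` for `τ ∈ (0,1)`. [folklore] -/
private theorem cwf211_pos {τ : ℝ} (h0 : 0 < τ) (h1 : τ < 1) (x : PL) : 0 < cwf211 τ x := by
  simp only [cwf211]; split_ifs <;> linarith

/-- **Product form of the law of `[211]`**: `P(s) = f(s₁) · 1 · 1`. [cite: LeGall2014, Prop. 4.1] -/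
theorem cwP211_prod (τ : ℝ) (s : PL × PL × PL) (hs : s ∈ cwS211) :
    cwP211 τ s = cwf211 τ s.1 * (fun _ : PL => (1 : ℝ)) s.2.1 * (fun _ : PL => (1 : ℝ)) s.2.2 := by
  simp only [cwP211, cwf211, if_pos hs, mul_one]

/-- The `x`-marginal: `(1,1) ↦ τ`, `(2,0), (0,2) ↦ (1−τ)/2`. [cite: CoppersmithWinograd1990, §8] -/
theorem marginalDist₁_cwP211 (τ : ℝ) : marginalDist₁ (cwP211 τ) = fun x =>
    if x = (1, 1) then τ else if x = (2, 0) then (1 - τ) / 2 else if x = (0, 2) then (1 - τ) / 2 else 0 := by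
  obtain ⟨e1, e2, e3, e4⟩ := cwP211_values τ
  funext x
  rw [marginalDist₁_eq_sum_filter cwS211 (cwP211_eq_zero τ)]
  obtain ⟨a, b⟩ := x
  fin_cases a <;> fin_cases b <;>
    simp [cwS211, Finset.filter_insert, Finset.filter_singleton, e1, e2, e3, e4]

/-- The `y`-marginal: `(1,0), (0,1) ↦ 1/2`. [cite: CoppersmithWinograd1990, §8] -/
theorem marginalDist₂_cwP211 (τ : ℝ) : marginalDist₂ (cwP211 τ) = fun y =>
    if y = (1, 0) then 1 / 2 else if y = (0, 1) then 1 / 2 else 0 := by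
  obtain ⟨e1, e2, e3, e4⟩ := cwP211_values τ
  funext y
  rw [marginalDist₂_eq_sum_filter cwS211 (cwP211_eq_zero τ)]
  obtain ⟨a, b⟩ := y
  fin_cases a <;> fin_cases b <;>
    simp [cwS211, Finset.filter_insert, Finset.filter_singleton, e1, e2, e3, e4] <;> ring

/-- The `z`-marginal: `(1,0), (0,1) ↦ 1/2`. [cite: CoppersmithWinograd1990, §8] -/
theorem marginalDist₃_cwP211 (τ : ℝ) : marginalDist₃ (cwP211 τ) = fun z =>
    if z = (1, 0) then 1 / 2 else if z = (0, 1) then 1 / 2 else 0 := by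
  obtain ⟨e1, e2, e3, e4⟩ := cwP211_values τ
  funext z
  rw [marginalDist₃_eq_sum_filter cwS211 (cwP211_eq_zero τ)]
  obtain ⟨a, b⟩ := z
  fin_cases a <;> fin_cases b <;>
    simp [cwS211, Finset.filter_insert, Finset.filter_singleton, e1, e2, e3, e4] <;> ring

/-- `H(x-marginal of [211]) = H₃(τ) = (2η((1−τ)/2) + η(τ))/ln 2` bits. [cite: CoppersmithWinograd1990, §8] -/
theorem shannonEntropy_marginalDist₁_cwP211 (τ : ℝ) : shannonEntropy (marginalDist₁ (cwP211 τ)) =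
    (2 * negMulLog ((1 - τ) / 2) + negMulLog τ) / Real.log 2 := by
  rw [marginalDist₁_cwP211, shannonEntropy_def, Fintype.sum_prod_type]
  simp only [Fin.sum_univ_three]
  simp
  ring

/-- `H(y-marginal of [211]) = 1` bit. [cite: CoppersmithWinograd1990, §8] -/
theorem shannonEntropy_marginalDist₂_cwP211 (τ : ℝ) : shannonEntropy (marginalDist₂ (cwP211 τ)) = 1 := by
  rw [marginalDist₂_cwP211, shannonEntropy_def, Fintype.sum_prod_type]
  simp only [Fin.sum_univ_three]
  have hl : Real.log 2 ≠ 0 := (Real.log_pos one_lt_two).ne'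
  simp [Real.negMulLog, Real.log_inv]
  field_simp
  norm_num

/-- `H(z-marginal of [211]) = 1` bit. [cite: CoppersmithWinograd1990, §8] -/
theorem shannonEntropy_marginalDist₃_cwP211 (τ : ℝ) : shannonEntropy (marginalDist₃ (cwP211 τ)) = 1 := by
  rw [marginalDist₃_cwP211, shannonEntropy_def, Fintype.sum_prod_type]
  simp only [Fin.sum_univ_three]
  have hl : Real.log 2 ≠ 0 := (Real.log_pos one_lt_two).ne'
  simp [Real.negMulLog, Real.log_inv]
  field_simp
  norm_num

end Data211

/-! ## The zero-outs `T^{[112]}'` and `T^{[121]}'` and their pair data -/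

section Data112r

variable (K : Type u) [Field K] (q : ℕ)

/-- **`T^{[112]}'`**: the zero-out of `T^{[112]}` to the `z`-pair-label `(1,1)` (the two products
`T_{101}⊗T_{011}`, `T_{011}⊗T_{101}` of format `(1,q,q)`; the `(q,1,1)`-products are dropped —
the splitting `σ = 1` of Le Gall 2012 §6.1). [cite: LeGall2012, §6.1] [cite: CoppersmithWinograd1990, §8] -/
def cwSqComp112r : Fin (q + 2) × Fin (q + 2) → Fin (q + 2) × Fin (q + 2) → Fin (q + 2) × Fin (q + 2) → K :=
  partSubtensor cwPairLev cwPairLev cwPairLev (cwSqComp K q 1 1 2) Finset.univ Finset.univ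
    {((1 : Fin 3), (1 : Fin 3))}

/-- **`T^{[121]}'`**: the zero-out of `T^{[121]}` to the `y`-pair-label `(1,1)` (the two products
`T_{110}⊗T_{011}`, `T_{011}⊗T_{110}` of format `(q,q,1)`). [cite: LeGall2012, §6.1]
[cite: CoppersmithWinograd1990, §8] -/
def cwSqComp121r : Fin (q + 2) × Fin (q + 2) → Fin (q + 2) × Fin (q + 2) → Fin (q + 2) × Fin (q + 2) → K :=
  partSubtensor cwPairLev cwPairLev cwPairLev (cwSqComp K q 1 2 1) Finset.univ
    {((1 : Fin 3), (1 : Fin 3))} Finset.univ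

/-- `T^{[112]} ≥ T^{[112]}'` (zero-out). [cite: LeGall2012, §6.1] -/
theorem tensorRestrictsTo_cwSqComp112r : TensorRestrictsTo (cwSqComp K q 1 1 2) (cwSqComp112r K q) :=
  tensorRestrictsTo_partSubtensor _ _ _ _ _ _ _

/-- `T^{[121]} ≥ T^{[121]}'` (zero-out). [cite: LeGall2012, §6.1] -/
theorem tensorRestrictsTo_cwSqComp121r : TensorRestrictsTo (cwSqComp K q 1 2 1) (cwSqComp121r K q) :=
  tensorRestrictsTo_partSubtensor _ _ _ _ _ _ _

/-- The two pair components of `T^{[112]}'`. [cite: CoppersmithWinograd1990, §8] -/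
def cwS112r : Finset (PL × PL × PL) := {((1, 0), (0, 1), (1, 1)), ((0, 1), (1, 0), (1, 1))}

/-- The two pair components of `T^{[121]}'`. [cite: CoppersmithWinograd1990, §8] -/
def cwS121r : Finset (PL × PL × PL) := {((1, 0), (1, 1), (0, 1)), ((0, 1), (1, 1), (1, 0))}

/-- Tightness on `cwS112r`. [cite: LeGall2014, §5] -/
theorem cwTight112r_sum (s : PL × PL × PL) (hs : s ∈ cwS112r) (k : Fin 2) :
    cwTight112 s.1 k + cwTight112 s.2.1 k + cwTight112γ s.2.2 k = 0 := by
  simp only [cwS112r, Finset.mem_insert, Finset.mem_singleton] at hs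
  rcases hs with rfl | rfl <;> fin_cases k <;> simp [cwTight112, cwTight112γ]

/-- Tightness on `cwS121r`. [cite: LeGall2014, §5] -/
theorem cwTight121r_sum (s : PL × PL × PL) (hs : s ∈ cwS121r) (k : Fin 2) :
    cwTight112 s.1 k + cwTight112 s.2.1 k + cwTight112γ s.2.2 k = 0 := by
  simp only [cwS121r, Finset.mem_insert, Finset.mem_singleton] at hs
  rcases hs with rfl | rfl <;> fin_cases k <;> simp [cwTight112, cwTight112γ]

/-- **The pair labels of the support of `T^{[112]}'` lie in `cwS112r`.** [cite: CoppersmithWinograd1990, §8] -/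
theorem cwSqComp112r_support (x y z : Fin (q + 2) × Fin (q + 2)) (h : cwSqComp112r K q x y z ≠ 0) :
    (cwPairLev x, cwPairLev y, cwPairLev z) ∈ cwS112r := by
  rw [cwSqComp112r, partSubtensor_apply] at h
  split_ifs at h with hc
  · obtain ⟨-, -, hz⟩ := hc
    rw [Finset.mem_singleton] at hz
    obtain ⟨ex, ey, ez, h1, h2⟩ := cwSqComp_levels K q h
    simp only [Fin.isValue, Fin.val_two, Fin.val_one] at ex ey ez
    have hz' := hz
    simp only [cwPairLev, Prod.mk.injEq, Fin.ext_iff, cwLevel₃_val, Fin.isValue, Fin.val_one] at hz'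
    have bx1 := cwLevel_le_two x.1; have bx2 := cwLevel_le_two x.2
    simp only [cwS112r, Finset.mem_insert, Finset.mem_singleton, Prod.mk.injEq, cwPairLev, Fin.ext_iff,
      cwLevel₃_val, Fin.isValue, Fin.val_zero, Fin.val_one]
    omega
  · exact absurd rfl h

/-- **The pair labels of the support of `T^{[121]}'` lie in `cwS121r`.** [cite: CoppersmithWinograd1990, §8] -/
theorem cwSqComp121r_support (x y z : Fin (q + 2) × Fin (q + 2)) (h : cwSqComp121r K q x y z ≠ 0) :
    (cwPairLev x, cwPairLev y, cwPairLev z) ∈ cwS121r := by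
  rw [cwSqComp121r, partSubtensor_apply] at h
  split_ifs at h with hc
  · obtain ⟨-, hy, -⟩ := hc
    rw [Finset.mem_singleton] at hy
    obtain ⟨ex, ey, ez, h1, h2⟩ := cwSqComp_levels K q h
    simp only [Fin.isValue, Fin.val_two, Fin.val_one] at ex ey ez
    have hy' := hy
    simp only [cwPairLev, Prod.mk.injEq, Fin.ext_iff, cwLevel₃_val, Fin.isValue, Fin.val_one] at hy'
    have bx1 := cwLevel_le_two x.1; have bx2 := cwLevel_le_two x.2
    simp only [cwS121r, Finset.mem_insert, Finset.mem_singleton, Prod.mk.injEq, cwPairLev, Fin.ext_iff,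
      cwLevel₃_val, Fin.isValue, Fin.val_zero, Fin.val_one]
    omega
  · exact absurd rfl h

/-- The pair blocks of `T^{[112]}'` are pair blocks of `T^{[112]}`. [folklore] -/
private theorem cwSqComp112r_block (s : PL × PL × PL) (hs : s ∈ cwS112r) :
    partSubtensor cwPairLev cwPairLev cwPairLev (cwSqComp112r K q) {s.1} {s.2.1} {s.2.2} =
      partSubtensor cwPairLev cwPairLev cwPairLev (cwSqComp K q 1 1 2) {s.1} {s.2.1} {s.2.2} := by
  have hz : s.2.2 = ((1 : Fin 3), (1 : Fin 3)) := by
    simp only [cwS112r, Finset.mem_insert, Finset.mem_singleton] at hs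
    rcases hs with rfl | rfl <;> rfl
  rw [cwSqComp112r, partSubtensor_partSubtensor, Finset.univ_inter, Finset.univ_inter, ← hz,
    Finset.inter_self]

/-- The pair blocks of `T^{[121]}'` are pair blocks of `T^{[121]}`. [folklore] -/
private theorem cwSqComp121r_block (s : PL × PL × PL) (hs : s ∈ cwS121r) :
    partSubtensor cwPairLev cwPairLev cwPairLev (cwSqComp121r K q) {s.1} {s.2.1} {s.2.2} =
      partSubtensor cwPairLev cwPairLev cwPairLev (cwSqComp K q 1 2 1) {s.1} {s.2.1} {s.2.2} := by
  have hy : s.2.1 = ((1 : Fin 3), (1 : Fin 3)) := by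
    simp only [cwS121r, Finset.mem_insert, Finset.mem_singleton] at hs
    rcases hs with rfl | rfl <;> rfl
  rw [cwSqComp121r, partSubtensor_partSubtensor, Finset.univ_inter, Finset.univ_inter, ← hy,
    Finset.inter_self]

/-- **The two products of `T^{[112]}'` have format `(1,q,q)`** (`T_{101}⊗T_{011}`, `T_{011}⊗T_{101}`).
[cite: CoppersmithWinograd1990, §8] [cite: LeGall2012, §6.1] -/
theorem hasFormatValue_cwS112r (s : PL × PL × PL) (hs : s ∈ cwS112r) :
    HasFormatValue (partSubtensor cwPairLev cwPairLev cwPairLev (cwSqComp112r K q)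
      {s.1} {s.2.1} {s.2.2}) ((fun _ : PL × PL × PL => (1 : ℝ)) s)
      ((fun _ : PL × PL × PL => (1 : ℝ)) s) ((fun _ : PL × PL × PL => (q : ℝ)) s)
      ((fun _ : PL × PL × PL => (q : ℝ)) s) := by
  have hq0 : (0 : ℝ) ≤ q := Nat.cast_nonneg q
  rw [cwSqComp112r_block K q s hs]
  simp only [cwS112r, Finset.mem_insert, Finset.mem_singleton] at hs
  rcases hs with rfl | rfl
  · rw [cwSqComp_pair, if_pos (by refine ⟨?_, ?_, ?_⟩ <;> ext <;> simp)]
    have h := (hasFormatValue_cwComp101 K q).kronecker (hasFormatValue_cwComp011 K q) zero_le_one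
      zero_le_one zero_le_one zero_le_one zero_le_one hq0 hq0 zero_le_one
    simpa using h
  · rw [cwSqComp_pair, if_pos (by refine ⟨?_, ?_, ?_⟩ <;> ext <;> simp)]
    have h := (hasFormatValue_cwComp011 K q).kronecker (hasFormatValue_cwComp101 K q) zero_le_one
      zero_le_one zero_le_one zero_le_one hq0 zero_le_one zero_le_one hq0
    simpa using h

/-- **The two products of `T^{[121]}'` have format `(q,q,1)`** (`T_{110}⊗T_{011}`, `T_{011}⊗T_{110}`).
[cite: CoppersmithWinograd1990, §8] [cite: LeGall2012, §6.1] -/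
theorem hasFormatValue_cwS121r (s : PL × PL × PL) (hs : s ∈ cwS121r) :
    HasFormatValue (partSubtensor cwPairLev cwPairLev cwPairLev (cwSqComp121r K q)
      {s.1} {s.2.1} {s.2.2}) ((fun _ : PL × PL × PL => (1 : ℝ)) s)
      ((fun _ : PL × PL × PL => (q : ℝ)) s) ((fun _ : PL × PL × PL => (q : ℝ)) s)
      ((fun _ : PL × PL × PL => (1 : ℝ)) s) := by
  have hq0 : (0 : ℝ) ≤ q := Nat.cast_nonneg q
  rw [cwSqComp121r_block K q s hs]
  simp only [cwS121r, Finset.mem_insert, Finset.mem_singleton] at hs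
  rcases hs with rfl | rfl
  · rw [cwSqComp_pair, if_pos (by refine ⟨?_, ?_, ?_⟩ <;> ext <;> simp)]
    have h := (hasFormatValue_cwComp110 K q).kronecker (hasFormatValue_cwComp011 K q) zero_le_one
      zero_le_one hq0 zero_le_one zero_le_one hq0 zero_le_one zero_le_one
    simpa using h
  · rw [cwSqComp_pair, if_pos (by refine ⟨?_, ?_, ?_⟩ <;> ext <;> simp)]
    have h := (hasFormatValue_cwComp011 K q).kronecker (hasFormatValue_cwComp110 K q) zero_le_one
      zero_le_one zero_le_one hq0 hq0 zero_le_one zero_le_one zero_le_one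
    simpa using h

/-- Counts of a two-product piece: `1` on each product (total `2`). [cite: LeGall2012, §6.1] -/
def cwC2r (S : Finset (PL × PL × PL)) (s : PL × PL × PL) : ℕ := if s ∈ S then 1 else 0

/-- Law of a two-product piece: `1/2` on each product. [cite: LeGall2012, §6.1] -/
def cwP2r (S : Finset (PL × PL × PL)) (s : PL × PL × PL) : ℝ := if s ∈ S then 1 / 2 else 0

/-- `cwC2r S` vanishes off `S`. [folklore] -/
private theorem cwC2r_eq_zero (S : Finset (PL × PL × PL)) (s : PL × PL × PL) (hs : s ∉ S) : cwC2r S s = 0 := by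
  simp [cwC2r, hs]

/-- `cwP2r S` vanishes off `S`. [folklore] -/
private theorem cwP2r_eq_zero (S : Finset (PL × PL × PL)) (s : PL × PL × PL) (hs : s ∉ S) : cwP2r S s = 0 := by
  simp [cwP2r, hs]

/-- `cwP2r S = cwC2r S / 2`. [folklore] -/
private theorem cwP2r_eq_cwC2_div (S : Finset (PL × PL × PL)) (s : PL × PL × PL) :
    cwP2r S s = (cwC2r S s : ℝ) / ((2 : ℕ) : ℝ) := by
  by_cases hs : s ∈ S <;> simp [cwP2r, cwC2r, hs]

/-- `∑ cwC2r cwS112r = 2`. [folklore] -/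
private theorem sum_cwC2_cwS112r : ∑ s, cwC2r cwS112r s = 2 := by
  rw [← Finset.sum_subset (Finset.subset_univ cwS112r) (fun s _ hs => cwC2r_eq_zero cwS112r s hs)]
  simp only [cwS112r]
  rw [Finset.sum_insert (by decide), Finset.sum_singleton]
  simp [cwC2r]

/-- `∑ cwC2r cwS121r = 2`. [folklore] -/
private theorem sum_cwC2_cwS121r : ∑ s, cwC2r cwS121r s = 2 := by
  rw [← Finset.sum_subset (Finset.subset_univ cwS121r) (fun s _ hs => cwC2r_eq_zero cwS121r s hs)]
  simp only [cwS121r]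
  rw [Finset.sum_insert (by decide), Finset.sum_singleton]
  simp [cwC2r]

/-- Product form of a two-product law: `P(s) = 1/2 · 1 · 1` on `S`. [cite: LeGall2014, Prop. 4.1] -/
theorem cwP2r_prod (S : Finset (PL × PL × PL)) (s : PL × PL × PL) (hs : s ∈ S) :
    cwP2r S s = (fun _ : PL => (1 / 2 : ℝ)) s.1 * (fun _ : PL => (1 : ℝ)) s.2.1 *
      (fun _ : PL => (1 : ℝ)) s.2.2 := by
  simp [cwP2r, hs]

/-- The marginals of the law of `T^{[112]}'`: `x`: `(1,0),(0,1) ↦ 1/2`. [cite: CoppersmithWinograd1990, §8] -/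
theorem marginalDist₁_cwP2_cwS112r : marginalDist₁ (cwP2r cwS112r) = fun x =>
    if x = (1, 0) then 1 / 2 else if x = (0, 1) then 1 / 2 else 0 := by
  funext x
  rw [marginalDist₁_eq_sum_filter cwS112r (cwP2r_eq_zero cwS112r)]
  obtain ⟨a, b⟩ := x
  fin_cases a <;> fin_cases b <;>
    simp [cwS112r, cwP2r, Finset.filter_insert, Finset.filter_singleton]

/-- `y`: `(1,0),(0,1) ↦ 1/2`. [cite: CoppersmithWinograd1990, §8] -/
theorem marginalDist₂_cwP2_cwS112r : marginalDist₂ (cwP2r cwS112r) = fun y =>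
    if y = (1, 0) then 1 / 2 else if y = (0, 1) then 1 / 2 else 0 := by
  funext y
  rw [marginalDist₂_eq_sum_filter cwS112r (cwP2r_eq_zero cwS112r)]
  obtain ⟨a, b⟩ := y
  fin_cases a <;> fin_cases b <;>
    simp [cwS112r, cwP2r, Finset.filter_insert, Finset.filter_singleton]

/-- `z`: `(1,1) ↦ 1`. [cite: CoppersmithWinograd1990, §8] -/
theorem marginalDist₃_cwP2_cwS112r : marginalDist₃ (cwP2r cwS112r) = fun z =>
    if z = (1, 1) then 1 else 0 := by
  funext z
  rw [marginalDist₃_eq_sum_filter cwS112r (cwP2r_eq_zero cwS112r)]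
  obtain ⟨a, b⟩ := z
  fin_cases a <;> fin_cases b <;>
    norm_num [cwS112r, cwP2r, Finset.filter_insert, Finset.filter_singleton]

/-- The marginals of the law of `T^{[121]}'`: `x`: `(1,0),(0,1) ↦ 1/2`. [cite: CoppersmithWinograd1990, §8] -/
theorem marginalDist₁_cwP2_cwS121r : marginalDist₁ (cwP2r cwS121r) = fun x =>
    if x = (1, 0) then 1 / 2 else if x = (0, 1) then 1 / 2 else 0 := by
  funext x
  rw [marginalDist₁_eq_sum_filter cwS121r (cwP2r_eq_zero cwS121r)]
  obtain ⟨a, b⟩ := x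
  fin_cases a <;> fin_cases b <;>
    simp [cwS121r, cwP2r, Finset.filter_insert, Finset.filter_singleton]

/-- `y`: `(1,1) ↦ 1`. [cite: CoppersmithWinograd1990, §8] -/
theorem marginalDist₂_cwP2_cwS121r : marginalDist₂ (cwP2r cwS121r) = fun y =>
    if y = (1, 1) then 1 else 0 := by
  funext y
  rw [marginalDist₂_eq_sum_filter cwS121r (cwP2r_eq_zero cwS121r)]
  obtain ⟨a, b⟩ := y
  fin_cases a <;> fin_cases b <;>
    norm_num [cwS121r, cwP2r, Finset.filter_insert, Finset.filter_singleton]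

/-- `z`: `(1,0),(0,1) ↦ 1/2`. [cite: CoppersmithWinograd1990, §8] -/
theorem marginalDist₃_cwP2_cwS121r : marginalDist₃ (cwP2r cwS121r) = fun z =>
    if z = (0, 1) then 1 / 2 else if z = (1, 0) then 1 / 2 else 0 := by
  funext z
  rw [marginalDist₃_eq_sum_filter cwS121r (cwP2r_eq_zero cwS121r)]
  obtain ⟨a, b⟩ := z
  fin_cases a <;> fin_cases b <;>
    simp [cwS121r, cwP2r, Finset.filter_insert, Finset.filter_singleton]

/-- Entropy of a law `1/2, 1/2` on two labels of `PL` (given as an `if`-chain): `1` bit. [folklore] -/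
private theorem shannonEntropy_two_halves (u v : PL) (huv : u ≠ v) :
    shannonEntropy (fun x : PL => if x = u then (1 : ℝ) / 2 else if x = v then 1 / 2 else 0) = 1 := by
  have hl : Real.log 2 ≠ 0 := (Real.log_pos one_lt_two).ne'
  rw [shannonEntropy_def]
  have hsum : ∑ x : PL, negMulLog (if x = u then (1 : ℝ) / 2 else if x = v then 1 / 2 else 0) =
      negMulLog (1 / 2) + negMulLog (1 / 2) := by
    rw [← Finset.sum_subset (Finset.subset_univ ({u, v} : Finset PL)) (fun x _ hx => by
      simp only [Finset.mem_insert, Finset.mem_singleton, not_or] at hx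
      simp [hx.1, hx.2])]
    rw [Finset.sum_insert (by simpa using huv), Finset.sum_singleton]
    simp [huv.symm]
  rw [hsum]
  simp [Real.negMulLog, Real.log_inv]
  field_simp
  norm_num

/-- Entropy of a point mass on `PL` (given as an `if`): `0`. [folklore] -/
private theorem shannonEntropy_dirac (u : PL) :
    shannonEntropy (fun x : PL => if x = u then (1 : ℝ) else 0) = 0 := by
  rw [shannonEntropy_def]
  have hsum : ∑ x : PL, negMulLog (if x = u then (1 : ℝ) else 0) = 0 := by
    refine Finset.sum_eq_zero fun x _ => ?_
    split_ifs <;> simp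
  rw [hsum, zero_div]

/-- The marginal entropies of `T^{[112]}'`: `(1, 1, 0)`. [cite: LeGall2012, §6.1] -/
theorem shannonEntropy_marginals_cwS112r :
    shannonEntropy (marginalDist₁ (cwP2r cwS112r)) = 1 ∧ shannonEntropy (marginalDist₂ (cwP2r cwS112r)) = 1 ∧
      shannonEntropy (marginalDist₃ (cwP2r cwS112r)) = 0 := by
  refine ⟨?_, ?_, ?_⟩
  · rw [marginalDist₁_cwP2_cwS112r]; exact shannonEntropy_two_halves _ _ (by decide)
  · rw [marginalDist₂_cwP2_cwS112r]; exact shannonEntropy_two_halves _ _ (by decide)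
  · rw [marginalDist₃_cwP2_cwS112r]; exact shannonEntropy_dirac _

/-- The marginal entropies of `T^{[121]}'`: `(1, 0, 1)`. [cite: LeGall2012, §6.1] -/
theorem shannonEntropy_marginals_cwS121r :
    shannonEntropy (marginalDist₁ (cwP2r cwS121r)) = 1 ∧ shannonEntropy (marginalDist₂ (cwP2r cwS121r)) = 0 ∧
      shannonEntropy (marginalDist₃ (cwP2r cwS121r)) = 1 := by
  refine ⟨?_, ?_, ?_⟩
  · rw [marginalDist₁_cwP2_cwS121r]; exact shannonEntropy_two_halves _ _ (by decide)
  · rw [marginalDist₂_cwP2_cwS121r]; exact shannonEntropy_dirac _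
  · rw [marginalDist₃_cwP2_cwS121r]; exact shannonEntropy_two_halves _ _ (by decide)

end Data112r

/-! ## The joint (pooled) format value of the family -/

section Family

variable (K : Type u) [Field K] (q : ℕ)

/-- **The family tensor** `F_q = (T^{[112]}' ⊗ T^{[121]}') ⊗ (T^{[211]} ⊗ T^{[211]})` (the four
family letters of a block of `(CW_q^{⊗2})^{⊗N}` in the proportion `1 : 1 : 2`, grouped for two
binary poolings). [cite: LeGall2012, §6.1 and Prop. 6.2] -/
abbrev cwSqFamily :=
  kroneckerTensor (kroneckerTensor (cwSqComp112r K q) (cwSqComp121r K q))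
    (kroneckerTensor (cwSqComp K q 2 1 1) (cwSqComp K q 2 1 1))

/-- Mass one of a two-product law (whole label set and support). [folklore] -/
private theorem cwP2r_sum_cwS112r : ∑ s, cwP2r cwS112r s = 1 ∧ ∑ s ∈ cwS112r, cwP2r cwS112r s = 1 :=
  law_sum_eq_one' (cwC2r_eq_zero cwS112r) (by norm_num) sum_cwC2_cwS112r (cwP2r_eq_cwC2_div cwS112r)

/-- Mass one of a two-product law (whole label set and support). [folklore] -/
private theorem cwP2r_sum_cwS121r : ∑ s, cwP2r cwS121r s = 1 ∧ ∑ s ∈ cwS121r, cwP2r cwS121r s = 1 :=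
  law_sum_eq_one' (cwC2r_eq_zero cwS121r) (by norm_num) sum_cwC2_cwS121r (cwP2r_eq_cwC2_div cwS121r)

/-- Mass one of the law of `[211]`. [folklore] -/
private theorem cwP211_sum {a b : ℕ} (hab : 0 < a + b) {τ : ℝ} (hτ : τ = (b : ℝ) / (a + b)) :
    ∑ s, cwP211 τ s = 1 ∧ ∑ s ∈ cwS211, cwP211 τ s = 1 :=
  law_sum_eq_one' (cwC211_eq_zero a b) (by omega) (sum_cwC211 a b) (cwP211_eq_cwC211_div hab hτ)

/-- `∏_S q^{P} = q` for a law of mass one on `S`. [folklore] -/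
private theorem prod_const_rpow {S : Finset (PL × PL × PL)} {P : PL × PL × PL → ℝ} (hq : 1 ≤ q)
    (hP : ∑ s ∈ S, P s = 1) : ∏ s ∈ S, (fun _ : PL × PL × PL => (q : ℝ)) s ^ P s = q := by
  have hq0 : (0 : ℝ) < q := by exact_mod_cast hq
  have h := Real.rpow_sum_of_pos hq0 P S
  simp only at h ⊢
  rw [← h, hP, Real.rpow_one]

/-- `∏_{cwS211} cwF211A^{P} = q^τ`. [folklore] -/
private theorem prod_cwF211A_rpow (hq : 1 ≤ q) (τ : ℝ) :
    ∏ s ∈ cwS211, cwF211A q s ^ cwP211 τ s = (q : ℝ) ^ τ := by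
  have hq0 : (0 : ℝ) < q := by exact_mod_cast hq
  obtain ⟨e1, e2, e3, e4⟩ := cwP211_values τ
  obtain ⟨a1, a2, a3, a4, b1, b2, b3, b4⟩ := cwF211_values q
  simp only [cwS211]
  rw [Finset.prod_insert (by decide), Finset.prod_insert (by decide), Finset.prod_insert (by decide),
    Finset.prod_singleton, e1, e2, e3, e4, a1, a2, a3, a4]
  simp only [Real.one_rpow, one_mul]
  rw [← Real.rpow_add hq0]
  ring_nf

/-- `∏_{cwS211} cwF211B^{P} = q^{1−τ}`. [folklore] -/
private theorem prod_cwF211B_rpow (hq : 1 ≤ q) (τ : ℝ) :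
    ∏ s ∈ cwS211, cwF211B q s ^ cwP211 τ s = (q : ℝ) ^ (1 - τ) := by
  have hq0 : (0 : ℝ) < q := by exact_mod_cast hq
  obtain ⟨e1, e2, e3, e4⟩ := cwP211_values τ
  obtain ⟨a1, a2, a3, a4, b1, b2, b3, b4⟩ := cwF211_values q
  simp only [cwS211]
  rw [Finset.prod_insert (by decide), Finset.prod_insert (by decide), Finset.prod_insert (by decide),
    Finset.prod_singleton, e1, e2, e3, e4, b1, b2, b3, b4]
  simp only [Real.one_rpow, mul_one]
  rw [← Real.rpow_add hq0]
  ring_nf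

set_option maxRecDepth 16384 in
set_option maxHeartbeats 1600000 in
/-- **Le Gall 2012 Prop. 6.2 / §6.1 in format currency: the joint format value of the family.**
For `q ≥ 1` and a rational splitting `τ = b/(a+b) ∈ (0,1)` of `[211]`, the family tensor
`F_q = (T^{[112]}' ⊗ T^{[121]}') ⊗ (T^{[211]} ⊗ T^{[211]})` is worth
`2^{min(2 + 2H₃(τ), 3)}` independent products of format `(q^{1+2τ}, q^{4−2τ}, q^{1+2τ})`,
`H₃(τ) = (2η((1−τ)/2) + η(τ))/ln 2`: two nested applications of the pooling theorem
`laserMethod_hasFormatValue_pair_of_mul` (pooled budgets `X : 1 + 1 + 2H₃(τ)`, `Y : 1 + 0 + 2`,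
`Z : 0 + 1 + 2`; all laws of product form, `Γ = 0`). [cite: LeGall2012, §6.1 and Prop. 6.2]
[cite: CoppersmithWinograd1990, §8] [cite: LeGall2014, Thm. 4.1 and §5] [cite: Coppersmith1997, §3] -/
theorem hasFormatValue_cwSqFamily (hq : 1 ≤ q) {a b : ℕ} (ha : 0 < a) (hb : 0 < b) {τ : ℝ}
    (hτ : τ = (b : ℝ) / (a + b)) :
    HasFormatValue (cwSqFamily K q)
      ((2 : ℝ) ^ min (2 + 2 * ((2 * negMulLog ((1 - τ) / 2) + negMulLog τ) / Real.log 2)) 3)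
      ((q : ℝ) ^ (1 + 2 * τ)) ((q : ℝ) ^ (4 - 2 * τ)) ((q : ℝ) ^ (1 + 2 * τ)) := by
  have hab : 0 < a + b := by omega
  have hab0 : (0 : ℝ) < (a : ℝ) + b := by exact_mod_cast hab
  have h0 : 0 < τ := by rw [hτ]; positivity
  have h1 : τ < 1 := by
    rw [hτ, div_lt_one hab0]; exact_mod_cast (show b < a + b by omega)
  have hq0 : (0 : ℝ) < (q : ℝ) := by exact_mod_cast hq
  -- primitive data: positivity
  have hone : ∀ s ∈ cwS112r, (0 : ℝ) < (fun _ : PL × PL × PL => (1 : ℝ)) s := fun _ _ => one_pos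
  have hone' : ∀ s ∈ cwS121r, (0 : ℝ) < (fun _ : PL × PL × PL => (1 : ℝ)) s := fun _ _ => one_pos
  have hone'' : ∀ s ∈ cwS211, (0 : ℝ) < (fun _ : PL × PL × PL => (1 : ℝ)) s := fun _ _ => one_pos
  have hcq : ∀ s ∈ cwS112r, (0 : ℝ) < (fun _ : PL × PL × PL => (q : ℝ)) s := fun _ _ => hq0
  have hcq' : ∀ s ∈ cwS121r, (0 : ℝ) < (fun _ : PL × PL × PL => (q : ℝ)) s := fun _ _ => hq0
  have hFA : ∀ s ∈ cwS211, 0 < cwF211A q s := fun s _ => cwF211A_pos q hq s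
  have hFB : ∀ s ∈ cwS211, 0 < cwF211B q s := fun s _ => cwF211B_pos q hq s
  have hhalf : ∀ x ∈ cwS112r, (0 : ℝ) < (fun _ : PL => (1 / 2 : ℝ)) x.1 := fun _ _ => by norm_num
  have hhalf' : ∀ x ∈ cwS121r, (0 : ℝ) < (fun _ : PL => (1 / 2 : ℝ)) x.1 := fun _ _ => by norm_num
  have hg1 : ∀ x ∈ cwS112r, (0 : ℝ) < (fun _ : PL => (1 : ℝ)) x.2.1 := fun _ _ => one_pos
  have hg1' : ∀ x ∈ cwS121r, (0 : ℝ) < (fun _ : PL => (1 : ℝ)) x.2.1 := fun _ _ => one_pos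
  have hg1'' : ∀ x ∈ cwS211, (0 : ℝ) < (fun _ : PL => (1 : ℝ)) x.2.1 := fun _ _ => one_pos
  have hh1 : ∀ x ∈ cwS112r, (0 : ℝ) < (fun _ : PL => (1 : ℝ)) x.2.2 := fun _ _ => one_pos
  have hh1' : ∀ x ∈ cwS121r, (0 : ℝ) < (fun _ : PL => (1 : ℝ)) x.2.2 := fun _ _ => one_pos
  have hh1'' : ∀ x ∈ cwS211, (0 : ℝ) < (fun _ : PL => (1 : ℝ)) x.2.2 := fun _ _ => one_pos
  have hf211 : ∀ x ∈ cwS211, 0 < cwf211 τ x.1 := fun x _ => cwf211_pos h0 h1 x.1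
  -- block values of the three pieces
  have hval₁ := fun s (hs : s ∈ cwS112r) => hasFormatValue_cwS112r K q s hs
  have hval₂ := fun s (hs : s ∈ cwS121r) => hasFormatValue_cwS121r K q s hs
  have hval₃ : ∀ s ∈ cwS211, HasFormatValue (partSubtensor cwPairLev cwPairLev cwPairLev
      (cwSqComp K q 2 1 1) {s.1} {s.2.1} {s.2.2}) ((fun _ : PL × PL × PL => (1 : ℝ)) s)
      (cwF211A q s) (cwF211B q s) (cwF211A q s) := fun s hs => hasFormatValue_cwS211 K q s hs
  -- supports
  have hS₁ := cwSqComp112r_support K q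
  have hS₂ := cwSqComp121r_support K q
  have hS₃ := cwSqComp211_support K q
  -- the nested pooled value
  have key := laserMethod_hasFormatValue_pair_of_mul
    (kroneckerTensor (cwSqComp112r K q) (cwSqComp121r K q)) _ _ _ (pairSupport cwS112r cwS121r)
    (pair_support_mem (cwSqComp112r K q) cwPairLev cwPairLev cwPairLev cwS112r hS₁
      (cwSqComp121r K q) cwPairLev cwPairLev cwPairLev cwS121r hS₂)
    (appendRows cwTight112 cwTight112) (appendRows cwTight112 cwTight112)
    (appendRows cwTight112γ cwTight112γ)
    (appendRows_injective cwTight112_injective cwTight112_injective)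
    (appendRows_injective cwTight112_injective cwTight112_injective)
    (appendRows_injective cwTight112γ_injective cwTight112γ_injective)
    (abs_appendRows_le cwTight112_bound cwTight112_bound)
    (abs_appendRows_le cwTight112_bound cwTight112_bound)
    (appendRows_tight cwTight112r_sum cwTight121r_sum)
    (pairVal (fun _ : PL × PL × PL => (1 : ℝ)) (fun _ : PL × PL × PL => (1 : ℝ)))
    (pairVal (fun _ : PL × PL × PL => (1 : ℝ)) (fun _ : PL × PL × PL => (q : ℝ)))
    (pairVal (fun _ : PL × PL × PL => (q : ℝ)) (fun _ : PL × PL × PL => (q : ℝ)))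
    (pairVal (fun _ : PL × PL × PL => (q : ℝ)) (fun _ : PL × PL × PL => (1 : ℝ)))
    (pairVal_pos cwS112r cwS121r hone hone') (pairVal_pos cwS112r cwS121r hone hcq')
    (pairVal_pos cwS112r cwS121r hcq hcq') (pairVal_pos cwS112r cwS121r hcq hone')
    (hasFormatValue_pair_blocks (cwSqComp112r K q) cwPairLev cwPairLev cwPairLev cwS112r _ _ _ _
      hone hone hcq hcq hval₁ (cwSqComp121r K q) cwPairLev cwPairLev cwPairLev cwS121r _ _ _ _
      hone' hcq' hcq' hone' hval₂)
    (fun s => cwC2r cwS112r (pairFst s) * cwC2r cwS121r (pairSnd s))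
    (pairCount_eq_zero cwS112r cwS121r (cwC2r_eq_zero cwS112r) (cwC2r_eq_zero cwS121r))
    (by norm_num : 0 < 2 * 2) (sum_pairCount sum_cwC2_cwS112r sum_cwC2_cwS121r)
    (pairLaw (cwP2r cwS112r) (cwP2r cwS121r))
    (pairLaw_eq_pairCount_div (cwP2r_eq_cwC2_div cwS112r) (cwP2r_eq_cwC2_div cwS121r))
    (fun i : PL × PL => (fun _ : PL => (1 / 2 : ℝ)) i.1 * (fun _ : PL => (1 / 2 : ℝ)) i.2)
    (fun j : PL × PL => (fun _ : PL => (1 : ℝ)) j.1 * (fun _ : PL => (1 : ℝ)) j.2)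
    (fun l : PL × PL => (fun _ : PL => (1 : ℝ)) l.1 * (fun _ : PL => (1 : ℝ)) l.2)
    (pairFactor₁_pos cwS112r cwS121r (f := fun _ : PL => (1 / 2 : ℝ)) (f' := fun _ : PL => (1 / 2 : ℝ))
      hhalf hhalf')
    (pairFactor₂_pos cwS112r cwS121r (g := fun _ : PL => (1 : ℝ)) (g' := fun _ : PL => (1 : ℝ)) hg1 hg1')
    (pairFactor₃_pos cwS112r cwS121r (h := fun _ : PL => (1 : ℝ)) (h' := fun _ : PL => (1 : ℝ)) hh1 hh1')
    (pairLaw_productForm cwS112r cwS121r (fun _ : PL => (1 / 2 : ℝ)) (fun _ : PL => (1 : ℝ))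
      (fun _ : PL => (1 : ℝ)) (cwP2r_prod cwS112r) (fun _ : PL => (1 / 2 : ℝ)) (fun _ : PL => (1 : ℝ))
      (fun _ : PL => (1 : ℝ)) (cwP2r_prod cwS121r))
    (kroneckerTensor (cwSqComp K q 2 1 1) (cwSqComp K q 2 1 1)) _ _ _ (pairSupport cwS211 cwS211)
    (pair_support_mem (cwSqComp K q 2 1 1) cwPairLev cwPairLev cwPairLev cwS211 hS₃
      (cwSqComp K q 2 1 1) cwPairLev cwPairLev cwPairLev cwS211 hS₃)
    (appendRows cwTight112 cwTight112) (appendRows cwTight112 cwTight112)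
    (appendRows cwTight112γ cwTight112γ)
    (appendRows_injective cwTight112_injective cwTight112_injective)
    (appendRows_injective cwTight112_injective cwTight112_injective)
    (appendRows_injective cwTight112γ_injective cwTight112γ_injective)
    (abs_appendRows_le cwTight112_bound cwTight112_bound)
    (abs_appendRows_le cwTight112_bound cwTight112_bound)
    (appendRows_tight cwTight211_sum cwTight211_sum)
    (pairVal (fun _ : PL × PL × PL => (1 : ℝ)) (fun _ : PL × PL × PL => (1 : ℝ)))
    (pairVal (cwF211A q) (cwF211A q)) (pairVal (cwF211B q) (cwF211B q))
    (pairVal (cwF211A q) (cwF211A q))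
    (pairVal_pos cwS211 cwS211 hone'' hone'') (pairVal_pos cwS211 cwS211 hFA hFA)
    (pairVal_pos cwS211 cwS211 hFB hFB) (pairVal_pos cwS211 cwS211 hFA hFA)
    (hasFormatValue_pair_blocks (cwSqComp K q 2 1 1) cwPairLev cwPairLev cwPairLev cwS211 _ _ _ _
      hone'' hFA hFB hFA hval₃ (cwSqComp K q 2 1 1) cwPairLev cwPairLev cwPairLev cwS211 _ _ _ _
      hone'' hFA hFB hFA hval₃)
    (fun s => cwC211 a b (pairFst s) * cwC211 a b (pairSnd s))
    (pairCount_eq_zero cwS211 cwS211 (cwC211_eq_zero a b) (cwC211_eq_zero a b))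
    (Nat.mul_pos (by omega : 0 < 2 * (a + b)) (by omega : 0 < 2 * (a + b)))
    (sum_pairCount (sum_cwC211 a b) (sum_cwC211 a b))
    (pairLaw (cwP211 τ) (cwP211 τ))
    (pairLaw_eq_pairCount_div (cwP211_eq_cwC211_div hab hτ) (cwP211_eq_cwC211_div hab hτ))
    (fun i : PL × PL => cwf211 τ i.1 * cwf211 τ i.2)
    (fun j : PL × PL => (fun _ : PL => (1 : ℝ)) j.1 * (fun _ : PL => (1 : ℝ)) j.2)
    (fun l : PL × PL => (fun _ : PL => (1 : ℝ)) l.1 * (fun _ : PL => (1 : ℝ)) l.2)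
    (pairFactor₁_pos cwS211 cwS211 (f := cwf211 τ) (f' := cwf211 τ) hf211 hf211)
    (pairFactor₂_pos cwS211 cwS211 (g := fun _ : PL => (1 : ℝ)) (g' := fun _ : PL => (1 : ℝ)) hg1'' hg1'')
    (pairFactor₃_pos cwS211 cwS211 (h := fun _ : PL => (1 : ℝ)) (h' := fun _ : PL => (1 : ℝ)) hh1'' hh1'')
    (pairLaw_productForm cwS211 cwS211 (cwf211 τ) (fun _ : PL => (1 : ℝ)) (fun _ : PL => (1 : ℝ))
      (cwP211_prod τ) (cwf211 τ) (fun _ : PL => (1 : ℝ)) (fun _ : PL => (1 : ℝ)) (cwP211_prod τ))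
  -- entropies and products of the four pieces
  obtain ⟨hP1₁, hPS1₁⟩ := cwP2r_sum_cwS112r
  obtain ⟨hP1₂, hPS1₂⟩ := cwP2r_sum_cwS121r
  obtain ⟨hP1₃, hPS1₃⟩ := cwP211_sum hab hτ
  obtain ⟨eH1, eH2, eH3⟩ := shannonEntropy_marginals_pairLaw hP1₁ hP1₂
    (P := cwP2r cwS112r) (P' := cwP2r cwS121r)
  obtain ⟨eH1', eH2', eH3'⟩ := shannonEntropy_marginals_pairLaw hP1₃ hP1₃
    (P := cwP211 τ) (P' := cwP211 τ)
  obtain ⟨a1, a2, a3⟩ := shannonEntropy_marginals_cwS112r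
  obtain ⟨b1, b2, b3⟩ := shannonEntropy_marginals_cwS121r
  rw [eH1, eH2, eH3, eH1', eH2', eH3', a1, a2, a3, b1, b2, b3,
    shannonEntropy_marginalDist₁_cwP211, shannonEntropy_marginalDist₂_cwP211,
    shannonEntropy_marginalDist₃_cwP211,
    prod_pairSupport_pairVal_rpow cwS112r cwS121r _ _ _ _ hone hone' hPS1₁ hPS1₂,
    prod_pairSupport_pairVal_rpow cwS112r cwS121r _ _ _ _ hone hcq' hPS1₁ hPS1₂,
    prod_pairSupport_pairVal_rpow cwS112r cwS121r _ _ _ _ hcq hcq' hPS1₁ hPS1₂,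
    prod_pairSupport_pairVal_rpow cwS112r cwS121r _ _ _ _ hcq hone' hPS1₁ hPS1₂,
    prod_pairSupport_pairVal_rpow cwS211 cwS211 _ _ _ _ hone'' hone'' hPS1₃ hPS1₃,
    prod_pairSupport_pairVal_rpow cwS211 cwS211 _ _ _ _ hFA hFA hPS1₃ hPS1₃,
    prod_pairSupport_pairVal_rpow cwS211 cwS211 _ _ _ _ hFB hFB hPS1₃ hPS1₃] at key
  simp only [Real.one_rpow, Finset.prod_const_one, prod_const_rpow q hq hPS1₁, prod_const_rpow q hq hPS1₂,
    prod_cwF211A_rpow q hq τ, prod_cwF211B_rpow q hq τ, mul_one, one_mul, add_zero, zero_add] at key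
  -- normal forms of the numbers
  convert key using 2
  · rw [show (1 : ℝ) + 1 + ((2 * negMulLog ((1 - τ) / 2) + negMulLog τ) / Real.log 2 +
        (2 * negMulLog ((1 - τ) / 2) + negMulLog τ) / Real.log 2) =
        2 + 2 * ((2 * negMulLog ((1 - τ) / 2) + negMulLog τ) / Real.log 2) by ring]
    norm_num
  · rw [show (1 : ℝ) + 2 * τ = 1 + (τ + τ) by ring, Real.rpow_add hq0, Real.rpow_add hq0, Real.rpow_one]
  · rw [show (4 : ℝ) - 2 * τ = 1 + 1 + ((1 - τ) + (1 - τ)) by ring, Real.rpow_add hq0,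
      Real.rpow_add hq0, Real.rpow_add hq0, Real.rpow_one]
  · rw [show (1 : ℝ) + 2 * τ = 1 + (τ + τ) by ring, Real.rpow_add hq0, Real.rpow_add hq0, Real.rpow_one]

end Family

/-! ## The family word and its laser block -/

section FamilyWord

variable (K : Type u) [Field K] (q : ℕ)

/-- **The family word** `((1,1,2), (1,2,1), (2,1,1), (2,1,1))` (letters of `CW_q^{⊗2}` in the
proportion `[112] : [121] : [211] = 1 : 1 : 2`, bracketed as `((·,·),(·,·))` for the two binary
poolings of `hasFormatValue_cwSqFamily`). [cite: LeGall2012, §6.1] -/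
def cwSqFamWord : Fin (1 + 1 + (1 + 1)) → Fin 5 × Fin 5 × Fin 5 :=
  Fin.append
    (Fin.append (fun _ : Fin 1 => ((1 : Fin 5), (1 : Fin 5), (2 : Fin 5)))
      (fun _ : Fin 1 => ((1 : Fin 5), (2 : Fin 5), (1 : Fin 5))))
    (Fin.append (fun _ : Fin 1 => ((2 : Fin 5), (1 : Fin 5), (1 : Fin 5)))
      (fun _ : Fin 1 => ((2 : Fin 5), (1 : Fin 5), (1 : Fin 5))))

/-- The letters of the family word. [cite: LeGall2012, §6.1] -/
theorem cwSqFamWord_mem (ρ : Fin (1 + 1 + (1 + 1))) :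
    cwSqFamWord ρ ∈ ({((1 : Fin 5), (1 : Fin 5), (2 : Fin 5)), (1, 2, 1), (2, 1, 1)} :
      Finset (Fin 5 × Fin 5 × Fin 5)) := by
  revert ρ
  decide

/-- The type of a one-letter word. [cite: LeGall2014, Appendix A.3] -/
theorem letterCount_one {α : Type} [DecidableEq α] (a s : α) :
    letterCount (fun _ : Fin 1 => a) s = if s = a then 1 else 0 := by
  rw [letterCount_apply]
  by_cases h : s = a
  · subst h; simp
  · rw [if_neg h]; simp [Ne.symm h]

/-- The type of a constant word of length `n`. [cite: LeGall2014, §2.2 and Appendix A.3] -/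
theorem letterCount_const {α : Type} [DecidableEq α] (n : ℕ) (a s : α) :
    letterCount (fun _ : Fin n => a) s = if s = a then n else 0 := by
  rw [letterCount_apply]
  by_cases h : s = a
  · subst h; simp
  · rw [if_neg h]; simp [Ne.symm h]

/-- The letter counts of the family word: `1, 1, 2`. [cite: LeGall2012, §6.1] -/
theorem letterCount_cwSqFamWord (s : Fin 5 × Fin 5 × Fin 5) :
    letterCount cwSqFamWord s =
      (if s = (1, 1, 2) then 1 else 0) + (if s = (1, 2, 1) then 1 else 0) +
        (if s = (2, 1, 1) then 2 else 0) := by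
  simp only [cwSqFamWord, letterCount_append, Pi.add_apply, letterCount_one]
  split_ifs <;> omega

/-- **The laser block of the family word restricts to the family tensor**
`(CW_q^{⊗2})^{⊗4}(cwSqFamWord) ≥ (T^{[112]}' ⊗ T^{[121]}') ⊗ (T^{[211]} ⊗ T^{[211]})`
(block of a concatenation ⊇ Kronecker product of blocks; one-letter blocks are the components;
then the two zero-outs). [cite: LeGall2012, §6.1] [cite: LeGall2014, Appendix A.3] -/
theorem tensorRestrictsTo_laserBlock_cwSqFamWord :
    TensorRestrictsTo (laserBlock cwLev2 cwLev2 cwLev2 (bigCwSq K q) cwSqFamWord)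
      (cwSqFamily K q) := by
  refine (tensorRestrictsTo_laserBlock_append _ _ _ _ _ _).trans (TensorRestrictsTo.kronecker ?_ ?_)
  · refine (tensorRestrictsTo_laserBlock_append _ _ _ _ _ _).trans (TensorRestrictsTo.kronecker ?_ ?_)
    · exact (tensorRestrictsTo_laserBlock_one _ _ _ _ _).trans (tensorRestrictsTo_cwSqComp112r K q)
    · exact (tensorRestrictsTo_laserBlock_one _ _ _ _ _).trans (tensorRestrictsTo_cwSqComp121r K q)
  · exact (tensorRestrictsTo_laserBlock_append _ _ _ _ _ _).trans (TensorRestrictsTo.kronecker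
      (tensorRestrictsTo_laserBlock_one _ _ _ _ _) (tensorRestrictsTo_laserBlock_one _ _ _ _ _))

/-- **The format value of the family block** (Le Gall 2012 Prop. 6.2, format currency):
`(CW_q^{⊗2})^{⊗4}(cwSqFamWord)` is worth `2^{min(2 + 2H₃(τ), 3)}` independent products of format
`(q^{1+2τ}, q^{4−2τ}, q^{1+2τ})` for every rational splitting `τ = b/(a+b) ∈ (0,1)`.
[cite: LeGall2012, §6.1 and Prop. 6.2] [cite: CoppersmithWinograd1990, §8] -/
theorem hasFormatValue_laserBlock_cwSqFamWord (hq : 1 ≤ q) {a b : ℕ} (ha : 0 < a) (hb : 0 < b)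
    {τ : ℝ} (hτ : τ = (b : ℝ) / (a + b)) :
    HasFormatValue (laserBlock cwLev2 cwLev2 cwLev2 (bigCwSq K q) cwSqFamWord)
      ((2 : ℝ) ^ min (2 + 2 * ((2 * negMulLog ((1 - τ) / 2) + negMulLog τ) / Real.log 2)) 3)
      ((q : ℝ) ^ (1 + 2 * τ)) ((q : ℝ) ^ (4 - 2 * τ)) ((q : ℝ) ^ (1 + 2 * τ)) :=
  HasFormatValue.of_restrictsTo (tensorRestrictsTo_laserBlock_cwSqFamWord K q)
    (hasFormatValue_cwSqFamily K q hq ha hb hτ)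

end FamilyWord

end Literature.Computability.AlgebraicComplexity

end
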